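import Literature.Probability.LatticeModels.HarmonicExtension
import HarnessLib

/-!
# Chains of harmonic extensions: the analytic Markov property for a maneuver of the random walk

Topic `Literature/Probability/LatticeModels`; an instalment (item P5 of the road recorded in
`Sweep1Proofs.lean`, module docstring §2b) of the discharge programme for crit-ising.S18 /
Smirnov's Theorem 2.2. The weak Beurling estimate (Smirnov 2010, Lemma B.2, after Kesten) is
proved without random walks: a "maneuver" (exit rectangle `U₀` through the landing set `L₀`,
then `U₁` through `L₁`, …) is encoded by the chain of harmonic extensions
`M_i = harmExt (U i) (1_{L i} M_{i+1})`, `M_n = 1` (`chainM`, indexed by the number of remaining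
steps), its killed version on `Sᶜ` by `N_i` (`chainN`), and the probability of being killed before
leaving a finite region `W` by `killedIn S W` (harmonic on `S ∩ W`, `1` on `W ∖ S`, `0` off `W`).
The two facts replacing the strong Markov property are proved by the maximum principle:
**`M_i - N_i ≤ killedIn`** (`chainM_sub_chainN_le_killedIn`), and **a positive `N_i` is witnessed
by a walk in `S`** to a landing point where `N_{i+1}` is positive (`exists_walk_of_chainN_pos`, from
`exists_walk_pos_of_harmonic_pos`). Everything is proved and `[folklore]`.

## References

* S. Smirnov, Ann. of Math. 172 (2010) 1435–1467, App. B, Lemma B.2 — bib key `Smirnov2010`.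
-/

noncomputable section

namespace Literature.Probability.LatticeModels

open Set SimpleGraph

/-! ### The chain of a maneuver -/

section Chain

variable (U L : ℕ → Set (Site 2)) (S : Set (Site 2)) (n : ℕ)

open scoped Classical in
/-- **The free chain** `M_j`, indexed by the number `j` of remaining steps: `M₀ = 1` and
`M_{j+1}` is the harmonic extension into the rectangle `U (n-1-j)` of `M_j` restricted to the
landing set `L (n-1-j)` (zero elsewhere). `chainM U L n j` at step index `i = n - j` is the
probability that the walk started at `x` performs the remaining steps `i, …, n-1` of the maneuver
(exit `U i` through `L i`, then `U (i+1)` through `L (i+1)`, …). [folklore] -/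
def chainM : ℕ → Site 2 → ℝ
  | 0 => fun _ => 1
  | j + 1 => harmExt (U (n - 1 - j)) fun w => if w ∈ L (n - 1 - j) then chainM j w else 0

open scoped Classical in
/-- **The killed chain** `N_j`: the same with the walk killed on `Sᶜ` (harmonic extension into
`U i ∩ S`, data restricted to `L i ∩ S`, zero on `Sᶜ`). [folklore] -/
def chainN : ℕ → Site 2 → ℝ
  | 0 => fun _ => 1
  | j + 1 => harmExt (U (n - 1 - j) ∩ S) fun w => if w ∈ L (n - 1 - j) ∧ w ∈ S then chainN j w else 0

variable {U L S n}
variable (hU : ∀ i, (U i).Finite)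

include hU in
/-- `0 ≤ M_j ≤ 1`. [folklore] -/
theorem chainM_mem_Icc (j : ℕ) (x : Site 2) : chainM U L n j x ∈ Icc (0 : ℝ) 1 := by
  classical
  induction j generalizing x with
  | zero => simp [chainM]
  | succ j ih =>
    simp only [chainM]
    constructor
    · exact le_harmExt' (hU _) (fun w => by split_ifs <;> [exact (ih w).1; exact le_rfl]) x
    · exact harmExt_le' (hU _) (fun w => by split_ifs <;> [exact (ih w).2; exact zero_le_one]) x

include hU in
/-- `0 ≤ N_j ≤ 1`. [folklore] -/
theorem chainN_mem_Icc (j : ℕ) (x : Site 2) : chainN U L S n j x ∈ Icc (0 : ℝ) 1 := by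
  classical
  induction j generalizing x with
  | zero => simp [chainN]
  | succ j ih =>
    simp only [chainN]
    have hfin : (U (n - 1 - j) ∩ S).Finite := (hU _).subset inter_subset_left
    constructor
    · exact le_harmExt' hfin (fun w => by split_ifs <;> [exact (ih w).1; exact le_rfl]) x
    · exact harmExt_le' hfin (fun w => by split_ifs <;> [exact (ih w).2; exact zero_le_one]) x

/-! ### The killed walk's survival function and the comparison `M - N ≤ v` -/

open scoped Classical in
/-- **The probability of being killed before leaving `W`**: harmonic on `S ∩ W`, `= 1` on
`W ∖ S`, `= 0` off `W`. [folklore] -/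
def killedIn (S W : Set (Site 2)) : Site 2 → ℝ := harmExt (S ∩ W) fun w => if w ∈ W then 1 else 0

/-- `0 ≤ killedIn ≤ 1`. [folklore] -/
theorem killedIn_mem_Icc {S W : Set (Site 2)} (hW : W.Finite) (x : Site 2) : killedIn S W x ∈ Icc (0 : ℝ) 1 := by
  classical
  have hfin : (S ∩ W).Finite := hW.subset inter_subset_right
  exact ⟨le_harmExt' hfin (fun w => by split_ifs <;> norm_num) x,
    harmExt_le' hfin (fun w => by split_ifs <;> norm_num) x⟩

/-- `killedIn = 1` on `W ∖ S`. [folklore] -/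
theorem killedIn_of_mem_diff {S W : Set (Site 2)} (hW : W.Finite) {x : Site 2} (hxW : x ∈ W) (hxS : x ∉ S) :
    killedIn S W x = 1 := by
  classical
  have hfin : (S ∩ W).Finite := hW.subset inter_subset_right
  rw [killedIn, harmExt_of_not_mem hfin _ (fun h => hxS h.1), if_pos hxW]

include hU in
/-- **`M_j - N_j ≤ v` everywhere** (downward induction / analytic strong Markov property): the
probability of performing the rest of the maneuver, minus that of performing it without being
killed, is at most the probability of being killed before leaving `W`. Hypotheses: the rectangles
and landing sets lie in the finite `W`, landing sets are disjoint from their rectangles. [folklore] -/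
theorem chainM_sub_chainN_le_killedIn {W : Set (Site 2)} (hW : W.Finite) (hUW : ∀ i, U i ⊆ W) (hLW : ∀ i, L i ⊆ W)
    (hUL : ∀ i, Disjoint (U i) (L i)) (j : ℕ) (x : Site 2) :
    chainM U L n j x - chainN U L S n j x ≤ killedIn S W x := by
  classical
  induction j generalizing x with
  | zero => simp only [chainM, chainN, sub_self]; exact (killedIn_mem_Icc hW x).1
  | succ j ih =>
    set i := n - 1 - j with hi
    have hfinS : (U i ∩ S).Finite := (hU i).subset inter_subset_left
    have hfinW : (S ∩ W).Finite := hW.subset inter_subset_right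
    -- the data of the two chains at step `i`
    set gM : Site 2 → ℝ := fun w => if w ∈ L i then chainM U L n j w else 0 with hgM
    set gN : Site 2 → ℝ := fun w => if w ∈ L i ∧ w ∈ S then chainN U L S n j w else 0 with hgN
    have hM : chainM U L n (j + 1) = harmExt (U i) gM := rfl
    have hN : chainN U L S n (j + 1) = harmExt (U i ∩ S) gN := rfl
    -- the claim off `U i ∩ S`
    have hoff : ∀ y, y ∉ U i ∩ S → chainM U L n (j + 1) y - chainN U L S n (j + 1) y ≤ killedIn S W y := by
      intro y hy
      rw [hN, harmExt_of_not_mem hfinS _ hy]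
      by_cases hyU : y ∈ U i
      · -- inside the rectangle but killed: `N = 0`, `M ≤ 1 = v`
        have hyS : y ∉ S := fun h => hy ⟨hyU, h⟩
        have hyL : y ∉ L i := fun h => (hUL i).le_bot ⟨hyU, h⟩
        rw [hgN]; simp only [hyL, false_and, if_false, sub_zero]
        rw [killedIn_of_mem_diff hW (hUW i hyU) hyS]
        exact (chainM_mem_Icc hU (j + 1) y).2
      · rw [hM, harmExt_of_not_mem (hU i) _ hyU, hgM, hgN]
        simp only
        by_cases hyL : y ∈ L i
        · by_cases hyS : y ∈ S
          · simp only [hyL, hyS, and_self, if_true]; exact ih y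
          · simp only [hyL, hyS, and_false, if_true, if_false, sub_zero]
            rw [killedIn_of_mem_diff hW (hLW i hyL) hyS]
            exact (chainM_mem_Icc hU j y).2
        · simp only [hyL, false_and, if_false, sub_zero]; exact (killedIn_mem_Icc hW y).1
    by_cases hx : x ∈ U i ∩ S
    · -- inside: comparison principle for the harmonic function `M - N - v` on `U i ∩ S`
      have hharm : IsLatticeSubharmonicOn (fun y => chainM U L n (j + 1) y - chainN U L S n (j + 1) y) (U i ∩ S) := by
        intro y hy
        rw [show (fun y => chainM U L n (j + 1) y - chainN U L S n (j + 1) y) = chainM U L n (j + 1) - chainN U L S n (j + 1) from rfl,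
          latticeLaplacian_sub, hM, hN, harmExt_harmonicOn (hU i) gM y hy.1, harmExt_harmonicOn hfinS gN y hy]
        simp
      have hsup : IsLatticeSuperharmonicOn (killedIn S W) (U i ∩ S) := by
        intro y hy
        rw [killedIn, harmExt_harmonicOn hfinW _ y ⟨hy.2, hUW i hy.1⟩]
      have := le_of_sub_super_of_boundary hfinS hharm hsup (c := 0) (fun w hw => by rw [add_zero]; exact hoff w hw.1) x hx
      simpa using this
    · exact hoff x hx

/-! ### Positivity of the killed chain propagates along walks in `S` -/

include hU in
/-- **One step of the killed maneuver is witnessed by a walk in `S`.** If `N_{j+1} x > 0` at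
`x ∈ U i ∩ S` (`i = n-1-j`), there is a landing point `y ∈ L i ∩ S` with `N_j y > 0` and a lattice
walk from `x` to `y` with support in `S ∩ (U i ∪ {y})`. [folklore] -/
theorem exists_walk_of_chainN_pos (j : ℕ) {x : Site 2} (hx : x ∈ U (n - 1 - j) ∩ S)
    (hpos : 0 < chainN U L S n (j + 1) x) :
    ∃ y, y ∈ L (n - 1 - j) ∧ y ∈ S ∧ 0 < chainN U L S n j y ∧
      ∃ p : (zdGraph 2).Walk x y, ∀ z ∈ p.support, z ∈ S ∧ (z ∈ U (n - 1 - j) ∨ z = y) := by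
  classical
  set i := n - 1 - j with hi
  have hfinS : (U i ∩ S).Finite := (hU i).subset inter_subset_left
  set gN : Site 2 → ℝ := fun w => if w ∈ L i ∧ w ∈ S then chainN U L S n j w else 0 with hgN
  have hN : chainN U L S n (j + 1) = harmExt (U i ∩ S) gN := rfl
  rw [hN] at hpos
  obtain ⟨w, hwU, hwpos, p, hp⟩ := exists_walk_pos_of_harmonic_pos hfinS (harmExt_harmonicOn hfinS gN) hx hpos
  rw [harmExt_of_not_mem hfinS gN hwU, hgN] at hwpos
  simp only at hwpos
  split_ifs at hwpos with hw
  · refine ⟨w, hw.1, hw.2, hwpos, p, fun z hz => ?_⟩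
    rcases (hp z hz).2 with h | rfl
    · exact ⟨h.2, Or.inl h.1⟩
    · exact ⟨hw.2, Or.inr rfl⟩
  · exact absurd hwpos (lt_irrefl 0)

end Chain

end Literature.Probability.LatticeModels
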